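import Literature.NumberTheory.EllipticCurves.ZpExtensionEisensteinDVRSettingH4UnramifiedProofs
import Literature.NumberTheory.GaloisCohomology.Howard2004.DualityDatumLocalCupNaturalityProofs
import Literature.NumberTheory.GaloisCohomology.Howard2004.DualityDatumLocalValueTowerProofs
import Literature.NumberTheory.GaloisRepresentations.LocalGlobalCohomologyDualityProofs
import HarnessLib

/-!
# H.4 at the places `v ∈ S` for the curve's Eisenstein setting, I: the tower of induced local pairings
# (reduction compatibility `hB`, the value-tower clause `hQ`, the exponent `T`, and the index shift)

`Proofs` file (theorems only; no definition, no named fact, no instance, no `sorry`).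

Howard 2004, H.4 at a finite place `v`: `F_v ⊂ H¹(K_v, T)` and the transport of `F_{v̄}` are exact annihilators of each
other under the induced local pairing [Compositio Math. 140 (2004), §1.3, arXiv:1202.6340 p. 7 L78–82].  For `F_𝔮` of
Def. 3.1.2 at a place `v ∈ S` the tree's local condition is a SATURATED LEVEL CONDITION
`Tower.levelCondition (κ.eisensteinLocalReduce … (Sum.inr v)) p C (k+1)` of the tower
`j ↦ H¹(K_v, E_K[p^j] ⊗ A_{m,j}(ψ))` (`eisensteinSelmerStructure_inr_of_mem`, `…_inr_of_mem_of_not_mem`), and the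
cell's abstract descent `Tower.levelCondition_mem_iff_forall_pairing_eq_zero` (file
`TowerSaturatedAnnihilatorProofs`) turns H.4 there into level inputs on a tower of bi-additive pairings
`B_j : X_j × Y_j → Q_j` compatible with reductions (`hB`), a value tower with torsion-free limit (`hQ`), exponents
(`T`), and the duality / exactness inputs.  This file supplies, for the curve's tower
`W.eisensteinTower κ hm` (level `k` = `T^{(k)} = E_K[p^{k+1}] ⊗ A_{m,k+1}(ψ)`) and ANY family of H.4 data
`D k` over the level rings `A_{m,k+1}` satisfying the reduction identity `he_red` of the setting
(`SatisfiesH.e_red`; instantiated by `exists_eisensteinDualityData` / `eisensteinDVRSetting_e_red_of`):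

* §1 `Tower.levelCondition_succ_eq_levelCondition_shift` (abstract): for a tower with trivial bottom level,
  `levelCondition red p C (k+1)` is the level-`k` condition of the SHIFTED tower `j ↦ X_{j+1}` — so `F_𝔮` at
  `v ∈ S`, indexed from the zero module `E_K[1] ⊗ A_{m,0}`, is a level condition of the `D`-indexed tower
  `j ↦ H¹(K_v, T^{(j)})`, on which `B_j := (D j).localCup (Sum.inr v)` is defined with no case split;
  `eisensteinLocalReduce_succ_eq_cohomologyMap`: its reductions are the maps of `DVRSetting.cond_red`.
* §2 (T) `p^{k+1} · H¹(K_v, T^{(k)}) = 0 = p^{k+1} · H¹(K_v, Tw T^{(k)})`.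
* §3 (hφ) `reduce ∘ (k+1)(1) = k(1) ∘ reduce` on `A_{m,k+2}(1) → A_{m,k+1}(1)` for any data (`twistOne_apply`), and
  (hB) `H²(reduce(1)) (x ∪_{k+1} y) = H¹(red) x ∪_k H¹(red) y` — `DualityDatum.localCup_map` at `he_red`.
* §4 (hQ) `p · q = 0 ⇒ H²(reduce(1)) q = 0` on `H²(K_v, A_{m,k+2}(1))`, from
  `DualityDatum.cohomologyMap_two_eq_zero_of_prime_nsmul_eq_zero` with the tail form `λ_{k+2}`, a compatible
  logarithm of `μ_{p^{k+2}}` (`exists_compatible_muLog`), the dual family of `A_{m,k+2}` and the bijective local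
  invariant map of the Poitou–Tate named fact `poitouTate_selmerStructure_duality K` (taken as a hypothesis).
* §5 the three clauses packaged in the binder shapes of `Tower.levelCondition_mem_iff_forall_pairing_eq_zero`.

Cell `pub/bsd-print-x9` (STUB A, `hfin4`); (Dual), (Exact) and core isotropy (hC) are other files.  No summit statement
is proved here; BSD is not proved by any of this.  References: [Howard2004HeegnerKolyvagin] §1.3 H.4, §1.6, Def. 3.1.2;
[MilneADT2006] I Cor. 2.3, Thm. 2.6; [NeukirchSchmidtWingberg2008] I §4 (1.4.2); [SerreGaloisCohomology1997] I §2.2.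
-/

set_option autoImplicit false

noncomputable section

open Function NumberField IsDedekindDomain Field
open scoped NumberField ContRepresentation

/-! ## §1 The index shift of a tower with trivial bottom level -/

namespace Literature.NumberTheory.EllipticCurves.Tower

universe u

variable {H : ℕ → Type u} [∀ j, AddCommGroup (H j)] (red : ∀ j, H (j + 1) →+ H j)

/-- **Index shift of the saturated level conditions.**  If the bottom level `X_0` of a tower is trivial (for
Howard's `T_𝔮/p^j`: `j = 0`), the level-`(k+1)` condition of `(X_j, red_j)_j` with cores `C_j` is the level-`k`
condition of the shifted tower `(X_{j+1}, red_{j+1})_j` with cores `C_{j+1}`: a saturated family of the shifted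
tower extends (uniquely) by `x_0 = red_0 x_1`, and `p^a x_0 ∈ C_0` is automatic.
[cite: Howard2004HeegnerKolyvagin, Def. 2.1.1 and Def. 3.1.2 (propagation to the quotients T/p^k)]
[cite: MazurRubinMemoirs2004, Example 1.1.2] -/
theorem levelCondition_succ_eq_levelCondition_shift [Subsingleton (H 0)] (p : ℕ) (C : ∀ j, AddSubgroup (H j))
    (k : ℕ) :
    levelCondition red p C (k + 1) =
      levelCondition (H := fun j ↦ H (j + 1)) (fun j ↦ red (j + 1)) p (fun j ↦ C (j + 1)) k := by
  ext y
  rw [mem_levelCondition_iff, mem_levelCondition_iff]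
  constructor
  · rintro ⟨x, hx, rfl⟩
    rw [mem_saturatedFamilies_iff] at hx
    obtain ⟨hc, a, ha⟩ := hx
    exact ⟨fun j ↦ x (j + 1),
      (mem_saturatedFamilies_iff (H := fun j ↦ H (j + 1)) (fun j ↦ red (j + 1)) p (fun j ↦ C (j + 1)) _).2
        ⟨fun j ↦ hc (j + 1), a, fun j ↦ ha (j + 1)⟩, rfl⟩
  · rintro ⟨x, hx, rfl⟩
    rw [mem_saturatedFamilies_iff] at hx
    obtain ⟨hc, a, ha⟩ := hx
    have h0 : ∀ z : H 0, z ∈ C 0 := fun z ↦ (Subsingleton.elim 0 z) ▸ zero_mem (C 0)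
    refine ⟨fun j ↦ Nat.rec (motive := fun j ↦ H j) (red 0 (x 0)) (fun j _ ↦ x j) j,
      (mem_saturatedFamilies_iff red p C _).2 ⟨fun j ↦ ?_, a, fun j ↦ ?_⟩, rfl⟩
    · cases j with
      | zero => rfl
      | succ j => exact hc j
    · cases j with
      | zero => exact h0 _
      | succ j => exact ha j

end Literature.NumberTheory.EllipticCurves.Tower

/-! ## §§2–5 The curve's Eisenstein tower -/

namespace Literature.NumberTheory.EllipticCurves.IwasawaAlgebra.EisensteinCoeff

variable {p : ℕ} [Fact p.Prime]

/-- `reduce : A_{m,k'} → A_{m,k}` is a map of `ℤ_p`-algebras. [cite: Howard2004HeegnerKolyvagin, §2.2] -/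
theorem reduce_algebraMap (m : ℕ) {k k' : ℕ} (hkk' : k ≤ k') (z : ℤ_[p]) :
    reduce p m hkk' (algebraMap ℤ_[p] (EisensteinCoeff p m k') z) = algebraMap ℤ_[p] (EisensteinCoeff p m k) z := by
  change reduce p m hkk' (Ideal.Quotient.mk _ (algebraMap ℤ_[p] (IwasawaAlgebra p) z)) =
    Ideal.Quotient.mk _ (algebraMap ℤ_[p] (IwasawaAlgebra p) z)
  exact reduce_mk m hkk' _

end Literature.NumberTheory.EllipticCurves.IwasawaAlgebra.EisensteinCoeff

namespace WeierstrassCurve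

open Literature.NumberTheory.EllipticCurves Literature.NumberTheory.GaloisRepresentations
open Literature.NumberTheory.GaloisRepresentations.DiscreteGaloisModule
open Literature.NumberTheory.GaloisCohomology Literature.NumberTheory.GaloisCohomology.Howard2004
open Literature.NumberTheory.EllipticCurves.ZpExtension (EisensteinLevel)

variable {K : Type} [Field K] [NumberField K] (W : WeierstrassCurve ℚ) [W.IsElliptic] {p : ℕ} [hp : Fact p.Prime]
  (κ : ZpExtension K p) {m : ℕ} (hm : 1 ≤ m)

/-! ### §1′ The reductions of `F_𝔮`'s tower are the maps of `DVRSetting.cond_red` -/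

/-- **The one-step local reduction of the `F_𝔮` tower at level `j+1` IS `H¹(K_v, red_j)` of the curve's tower**
(`ContinuousRep.cohomologyMap` currency of `DVRSetting.cond_red`; both are Mathlib's `ContinuousCohomology.map` of
the same map `E_K[p^{j+2}] ⊗ A_{m,j+2} → E_K[p^{j+1}] ⊗ A_{m,j+1}`). [cite: Howard2004HeegnerKolyvagin, §1.6 (arXiv p. 12) and Lemma 3.2.7] -/
theorem eisensteinLocalReduce_succ_eq_cohomologyMap (v : Place K) (j : ℕ) :
    letI := IwasawaAlgebra.isLocalRing_quotient_X_pow_add_C p hm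
    κ.eisensteinLocalReduce (fun j ↦ (W.baseChange K).torsionGaloisModule ((p : ℤ) ^ j))
        (fun j ↦ (W.baseChange K).torsionGaloisModuleReduce p j) hm v (j + 1) =
      ContinuousRep.cohomologyMap (((W.eisensteinTower κ hm).ρ (j + 1)).toLocal v)
        (((W.eisensteinTower κ hm).ρ j).toLocal v) ((W.eisensteinTower κ hm).red j).toAddMonoidHom
        continuous_of_discreteTopology (fun _ z => (W.eisensteinTower κ hm).red_equivariant j _ z) 1 :=
  rfl

/-! ### §1″ `F_𝔮` at `v ∈ S` as a level condition of the `D`-indexed tower -/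

omit [W.IsElliptic] in
/-- The bottom level `E_K[1] ⊗ A_{m,0}(ψ)` of the `F_𝔮` tower is the zero module (`p^0 = 1 = 0` in `A_{m,0}`).
[cite: Howard2004HeegnerKolyvagin, §2.2 (A_{m,k} = Λ/(𝔮, p^k))] -/
theorem eisensteinLevel_zero_eq_zero (hm : 1 ≤ m)
    (x : IwasawaAlgebra.EisensteinCoeff.Twisted p m 0 (geomTorsion (W.baseChange K) ((p : ℤ) ^ 0))) : x = 0 := by
  haveI := IwasawaAlgebra.EisensteinCoeff.charP p hm 0
  have h1 : (1 : IwasawaAlgebra.EisensteinCoeff p m 0) = 0 := by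
    have h := (CharP.cast_eq_zero_iff (IwasawaAlgebra.EisensteinCoeff p m 0) (p ^ 0) 1).2 (by norm_num)
    rwa [Nat.cast_one] at h
  calc x = (1 : IwasawaAlgebra.EisensteinCoeff p m 0) • x := (one_smul _ _).symm
    _ = 0 := by rw [h1, zero_smul]

omit [W.IsElliptic] in
/-- Hence `H¹(K_v, E_K[1] ⊗ A_{m,0}(ψ))` is trivial. [cite: SerreGaloisCohomology1997, I §2.2] -/
theorem subsingleton_galoisCohomology_eisensteinLevel_zero (v : Place K) :
    Subsingleton (galoisCohomology
      ((κ.eisensteinTwist ((W.baseChange K).torsionGaloisModule ((p : ℤ) ^ 0)) hm 0).toLocal v) 1) := by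
  have hM : ∀ x : IwasawaAlgebra.EisensteinCoeff.Twisted p m 0 (geomTorsion (W.baseChange K) ((p : ℤ) ^ 0)),
      1 • x = 0 := fun x ↦ by
    rw [W.eisensteinLevel_zero_eq_zero hm x, smul_zero]
  have h : ∀ c : galoisCohomology
      ((κ.eisensteinTwist ((W.baseChange K).torsionGaloisModule ((p : ℤ) ^ 0)) hm 0).toLocal v) 1, c = 0 :=
    fun c ↦ by simpa using galoisCohomology.nsmul_eq_zero_of_forall _ hM c
  exact ⟨fun a b ↦ by rw [h a, h b]⟩

/-- **`F_𝔮`'s level-`(k+1)` condition at a finite place is the level-`k` condition of the `D`-indexed tower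
`j ↦ H¹(K_v, T^{(j)})` with the reductions of `DVRSetting.cond_red`** (index shift over the trivial bottom level; the
cores shift along).  With `C` the unramified cores (`eisensteinSelmerStructure_inr_of_mem_of_not_mem`) or the ordinary
cores (`eisensteinSelmerStructure_inr_of_mem`) this is the local condition of `W.eisensteinTowerTriple … k` at `v ∈ S`.
[cite: Howard2004HeegnerKolyvagin, Def. 3.1.2 and §1.6 (arXiv p. 12)] [cite: MazurRubinMemoirs2004, Example 1.1.2] -/
theorem levelCondition_eisensteinLocalReduce_succ (v : Place K)
    (C : ∀ j, AddSubgroup (galoisCohomology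
      ((κ.eisensteinTwist ((W.baseChange K).torsionGaloisModule ((p : ℤ) ^ j)) hm j).toLocal v) 1)) (k : ℕ) :
    letI := IwasawaAlgebra.isLocalRing_quotient_X_pow_add_C p hm
    Tower.levelCondition (κ.eisensteinLocalReduce (fun j ↦ (W.baseChange K).torsionGaloisModule ((p : ℤ) ^ j))
        (fun j ↦ (W.baseChange K).torsionGaloisModuleReduce p j) hm v) p C (k + 1) =
      Tower.levelCondition (H := fun j ↦ galoisCohomology (((W.eisensteinTower κ hm).ρ j).toLocal v) 1)
        (fun j ↦ ContinuousRep.cohomologyMap (((W.eisensteinTower κ hm).ρ (j + 1)).toLocal v)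
          (((W.eisensteinTower κ hm).ρ j).toLocal v) ((W.eisensteinTower κ hm).red j).toAddMonoidHom
          continuous_of_discreteTopology (fun _ z => (W.eisensteinTower κ hm).red_equivariant j _ z) 1)
        p (fun j ↦ C (j + 1)) k := by
  letI := IwasawaAlgebra.isLocalRing_quotient_X_pow_add_C p hm
  haveI := W.subsingleton_galoisCohomology_eisensteinLevel_zero κ hm v
  exact Tower.levelCondition_succ_eq_levelCondition_shift _ p C k

/-! ### §2 (T) the exponents -/

omit [W.IsElliptic] in
/-- The level `E_K[p^j] ⊗ A_{m,j}(ψ)` of the `F_𝔮` tower is killed by `p^j` (`p^j = 0` in `A_{m,j}`); Howard's `T^{(k)}` is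
`j = k+1`. [cite: Howard2004HeegnerKolyvagin, §2.2 (A_{m,k} = Λ/(𝔮, p^k))] -/
theorem eisensteinLevel_pow_nsmul_eq_zero (hm : 1 ≤ m) (j : ℕ)
    (x : IwasawaAlgebra.EisensteinCoeff.Twisted p m j (geomTorsion (W.baseChange K) ((p : ℤ) ^ j))) :
    p ^ j • x = 0 := by
  haveI := IwasawaAlgebra.EisensteinCoeff.charP p hm j
  rw [← Nat.cast_smul_eq_nsmul (IwasawaAlgebra.EisensteinCoeff p m j),
    CharP.cast_eq_zero (IwasawaAlgebra.EisensteinCoeff p m j) (p ^ j), zero_smul]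

omit [W.IsElliptic] in
/-- **(T) on the whole `F_𝔮` tower: `p^j · H¹(K_v, E_K[p^j] ⊗ A_{m,j}(ψ)) = 0`** (all `j`, the zero level included).
[cite: Howard2004HeegnerKolyvagin, §2.2] [cite: SerreGaloisCohomology1997, I §2.2] -/
theorem eisensteinTwist_toLocal_pow_nsmul_eq_zero (j : ℕ) (v : Place K)
    (x : galoisCohomology ((κ.eisensteinTwist ((W.baseChange K).torsionGaloisModule ((p : ℤ) ^ j)) hm j).toLocal v) 1) :
    p ^ j • x = 0 :=
  galoisCohomology.nsmul_eq_zero_of_forall _ (W.eisensteinLevel_pow_nsmul_eq_zero hm j) x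

omit [W.IsElliptic] in
/-- **(T′) on the twisted `F_𝔮` tower: `p^j · H¹(K_v, Tw(E_K[p^j] ⊗ A_{m,j}(ψ))) = 0`.**
[cite: Howard2004HeegnerKolyvagin, §2.2 and §1.3 (Tw)] [cite: SerreGaloisCohomology1997, I §2.2] -/
theorem eisensteinTwist_twist_toLocal_pow_nsmul_eq_zero (cd : ConjugationDatum K) (j : ℕ) (v : Place K)
    (y : galoisCohomology
      ((cd.twist (κ.eisensteinTwist ((W.baseChange K).torsionGaloisModule ((p : ℤ) ^ j)) hm j)).toLocal v) 1) :
    p ^ j • y = 0 :=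
  galoisCohomology.nsmul_eq_zero_of_forall _ (W.eisensteinLevel_pow_nsmul_eq_zero hm j) y

omit [W.IsElliptic] in
/-- Howard's level `T^{(k)} = E_K[p^{k+1}] ⊗ A_{m,k+1}(ψ)` (the tree's `EisensteinLevel … (k+1)`) is killed by `p^{k+1}`.
[cite: Howard2004HeegnerKolyvagin, §2.2 (A_{m,k} = Λ/(𝔮, p^k))] -/
theorem eisensteinLevel_succ_pow_nsmul_eq_zero (hm : 1 ≤ m) (k : ℕ)
    (x : EisensteinLevel p m (fun j ↦ geomTorsion (W.baseChange K) ((p : ℤ) ^ j)) (k + 1)) :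
    p ^ (k + 1) • x = 0 := by
  haveI := IwasawaAlgebra.EisensteinCoeff.charP p hm (k + 1)
  rw [← Nat.cast_smul_eq_nsmul (IwasawaAlgebra.EisensteinCoeff p m (k + 1)),
    CharP.cast_eq_zero (IwasawaAlgebra.EisensteinCoeff p m (k + 1)) (p ^ (k + 1)), zero_smul]

/-- **(T) `p^{k+1} · H¹(K_v, T^{(k)}) = 0`.** [cite: Howard2004HeegnerKolyvagin, §2.2] [cite: SerreGaloisCohomology1997, I §2.2] -/
theorem eisensteinTower_toLocal_pow_nsmul_eq_zero (k : ℕ) (v : Place K)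
    (x : letI := IwasawaAlgebra.isLocalRing_quotient_X_pow_add_C p hm
      galoisCohomology (((W.eisensteinTower κ hm).ρ k).toLocal v) 1) :
    p ^ (k + 1) • x = 0 :=
  galoisCohomology.nsmul_eq_zero_of_forall _ (W.eisensteinLevel_succ_pow_nsmul_eq_zero hm k) x

/-- **(T′) `p^{k+1} · H¹(K_v, Tw T^{(k)}) = 0`.** [cite: Howard2004HeegnerKolyvagin, §2.2 and §1.3 (Tw)] [cite: SerreGaloisCohomology1997, I §2.2] -/
theorem eisensteinTower_twist_toLocal_pow_nsmul_eq_zero (cd : ConjugationDatum K) (k : ℕ) (v : Place K)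
    (y : letI := IwasawaAlgebra.isLocalRing_quotient_X_pow_add_C p hm
      galoisCohomology ((cd.twist ((W.eisensteinTower κ hm).ρ k)).toLocal v) 1) :
    p ^ (k + 1) • y = 0 :=
  galoisCohomology.nsmul_eq_zero_of_forall _ (W.eisensteinLevel_succ_pow_nsmul_eq_zero hm k) y

/-! ### §3 (hφ) and (hB): the induced local pairings are compatible with reduction -/

variable (cd : ConjugationDatum K)
  (D : letI := IwasawaAlgebra.isLocalRing_quotient_X_pow_add_C p hm
    ∀ k, DualityDatum p cd ((W.eisensteinTower κ hm).ρ k) (IwasawaAlgebra.EisensteinCoeff p m (k + 1)))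

/-- **(hφ) The ring reduction intertwines the Tate twists `A_{m,k+2}(1) → A_{m,k+1}(1)`** of ANY two H.4 data (both
twists are pinned by `twistOne_apply`, and `reduce` is a `ℤ_p`-algebra map). [cite: Howard2004HeegnerKolyvagin, §1.3 H.4 (R(1)) and §2.2] -/
theorem reduce_twistOne (k : ℕ) (g : absoluteGaloisGroup K) (x : IwasawaAlgebra.EisensteinCoeff p m (k + 1 + 1)) :
    letI := IwasawaAlgebra.isLocalRing_quotient_X_pow_add_C p hm
    IwasawaAlgebra.EisensteinCoeff.reduce p m (Nat.le_succ (k + 1)) ((D (k + 1)).twistOne g x) =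
      (D k).twistOne g (IwasawaAlgebra.EisensteinCoeff.reduce p m (Nat.le_succ (k + 1)) x) := by
  letI := IwasawaAlgebra.isLocalRing_quotient_X_pow_add_C p hm
  rw [(D (k + 1)).twistOne_apply, (D k).twistOne_apply, map_mul, IwasawaAlgebra.EisensteinCoeff.reduce_algebraMap]

/-- **(hB) `H²(reduce(1)) (x ∪_{k+1} y) = H¹(red_k) x ∪_k H¹(red_k) y` at every place** — for H.4 data satisfying the
reduction identity `he_red` of the setting (`SatisfiesH.e_red`): `DualityDatum.localCup_map` at `r := red_k`,
`φ := reduce`. [cite: Howard2004HeegnerKolyvagin, §1.6 (arXiv p. 11, L33–38) and H.4 (p. 7, L78–82)]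
[cite: NeukirchSchmidtWingberg2008, I §4 (1.4.2)] -/
theorem eisensteinTower_localCup_red
    (he_red : letI := IwasawaAlgebra.isLocalRing_quotient_X_pow_add_C p hm
      ∀ k (x y : EisensteinLevel p m (fun j ↦ geomTorsion (W.baseChange K) ((p : ℤ) ^ j)) (k + 1 + 1)),
        IwasawaAlgebra.EisensteinCoeff.reduce p m (Nat.le_succ (k + 1)) ((D (k + 1)).e x y) =
          (D k).e ((W.eisensteinTower κ hm).red k x) ((W.eisensteinTower κ hm).red k y))
    (k : ℕ) (v : Place K)
    (x : letI := IwasawaAlgebra.isLocalRing_quotient_X_pow_add_C p hm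
      galoisCohomology (((W.eisensteinTower κ hm).ρ (k + 1)).toLocal v) 1)
    (y : letI := IwasawaAlgebra.isLocalRing_quotient_X_pow_add_C p hm
      galoisCohomology ((cd.twist ((W.eisensteinTower κ hm).ρ (k + 1))).toLocal v) 1) :
    letI := IwasawaAlgebra.isLocalRing_quotient_X_pow_add_C p hm
    ContinuousRep.cohomologyMap ((D (k + 1)).twistOne.toLocal v) ((D k).twistOne.toLocal v)
        (IwasawaAlgebra.EisensteinCoeff.reduce p m (Nat.le_succ (k + 1))).toAddMonoidHom
        continuous_of_discreteTopology (fun _ z => W.reduce_twistOne κ hm cd D k _ z) 2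
        ((D (k + 1)).localCup v x y) =
      (D k).localCup v
        (ContinuousRep.cohomologyMap (((W.eisensteinTower κ hm).ρ (k + 1)).toLocal v)
          (((W.eisensteinTower κ hm).ρ k).toLocal v) ((W.eisensteinTower κ hm).red k).toAddMonoidHom
          continuous_of_discreteTopology (fun _ z => (W.eisensteinTower κ hm).red_equivariant k _ z) 1 x)
        (ContinuousRep.cohomologyMap ((cd.twist ((W.eisensteinTower κ hm).ρ (k + 1))).toLocal v)
          ((cd.twist ((W.eisensteinTower κ hm).ρ k)).toLocal v) ((W.eisensteinTower κ hm).red k).toAddMonoidHom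
          continuous_of_discreteTopology (fun _ z => (W.eisensteinTower κ hm).red_equivariant k _ z) 1 y) := by
  letI := IwasawaAlgebra.isLocalRing_quotient_X_pow_add_C p hm
  exact (D (k + 1)).localCup_map (D k) ((W.eisensteinTower κ hm).red k).toAddMonoidHom
    (fun g z => (W.eisensteinTower κ hm).red_equivariant k g z) _
    (fun g z => W.reduce_twistOne κ hm cd D k g z) (fun s t => he_red k s t) v x y

/-- **(hB) in the literal currency of `F_𝔮`'s tower** (`eisensteinSelmerStructure`): the `X`-side reduction written as
`κ.eisensteinLocalReduce ρ t hm v (k+1)` (definitionally `H¹(red_k)`, `eisensteinLocalReduce_succ_eq_cohomologyMap`).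
[cite: Howard2004HeegnerKolyvagin, §1.6 (arXiv p. 11, L33–38), H.4 and Def. 3.1.2] [cite: NeukirchSchmidtWingberg2008, I §4 (1.4.2)] -/
theorem eisensteinTower_localCup_eisensteinLocalReduce
    (he_red : letI := IwasawaAlgebra.isLocalRing_quotient_X_pow_add_C p hm
      ∀ k (x y : EisensteinLevel p m (fun j ↦ geomTorsion (W.baseChange K) ((p : ℤ) ^ j)) (k + 1 + 1)),
        IwasawaAlgebra.EisensteinCoeff.reduce p m (Nat.le_succ (k + 1)) ((D (k + 1)).e x y) =
          (D k).e ((W.eisensteinTower κ hm).red k x) ((W.eisensteinTower κ hm).red k y))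
    (k : ℕ) (v : Place K)
    (x : galoisCohomology
      ((κ.eisensteinTwist ((W.baseChange K).torsionGaloisModule ((p : ℤ) ^ (k + 1 + 1))) hm (k + 1 + 1)).toLocal v) 1)
    (y : letI := IwasawaAlgebra.isLocalRing_quotient_X_pow_add_C p hm
      galoisCohomology ((cd.twist ((W.eisensteinTower κ hm).ρ (k + 1))).toLocal v) 1) :
    letI := IwasawaAlgebra.isLocalRing_quotient_X_pow_add_C p hm
    ContinuousRep.cohomologyMap ((D (k + 1)).twistOne.toLocal v) ((D k).twistOne.toLocal v)
        (IwasawaAlgebra.EisensteinCoeff.reduce p m (Nat.le_succ (k + 1))).toAddMonoidHom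
        continuous_of_discreteTopology (fun _ z => W.reduce_twistOne κ hm cd D k _ z) 2
        ((D (k + 1)).localCup v x y) =
      (D k).localCup v
        (κ.eisensteinLocalReduce (fun j ↦ (W.baseChange K).torsionGaloisModule ((p : ℤ) ^ j))
          (fun j ↦ (W.baseChange K).torsionGaloisModuleReduce p j) hm v (k + 1) x)
        (ContinuousRep.cohomologyMap ((cd.twist ((W.eisensteinTower κ hm).ρ (k + 1))).toLocal v)
          ((cd.twist ((W.eisensteinTower κ hm).ρ k)).toLocal v) ((W.eisensteinTower κ hm).red k).toAddMonoidHom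
          continuous_of_discreteTopology (fun _ z => (W.eisensteinTower κ hm).red_equivariant k _ z) 1 y) :=
  W.eisensteinTower_localCup_red κ hm cd D he_red k v x y

/-! ### §4 (hQ): `p · q = 0 ⇒ H²(reduce(1)) q = 0` -/

/-- **(hQ) for the value tower `H²(K_v, A_{m,k+1}(1))` of the curve's Eisenstein setting**: at a finite place `v`, every
`q ∈ H²(K_v, A_{m,k+2}(1))` with `p · q = 0` is killed by `H²(reduce(1))` — given the Poitou–Tate family of local
invariants (`poitouTate_selmerStructure_duality K`, for the bijection `inv_v : H²(K_v, μ_{p^{k+2}}) ≅ ℤ/p^{k+2}`).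
[cite: Howard2004HeegnerKolyvagin, §1.3 H.4 and §1.6 (arXiv p. 11, L33–38)] [cite: MilneADT2006, Ch. I, Cor. 2.3] -/
theorem eisensteinTower_cohomologyMap_two_eq_zero_of_prime_nsmul_eq_zero
    (hPT : poitouTate_selmerStructure_duality K) (k : ℕ) (v : HeightOneSpectrum (𝓞 K))
    (q : letI := IwasawaAlgebra.isLocalRing_quotient_X_pow_add_C p hm
      galoisCohomology ((D (k + 1)).twistOne.toLocal (Sum.inr v)) 2) (hq : p • q = 0) :
    letI := IwasawaAlgebra.isLocalRing_quotient_X_pow_add_C p hm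
    ContinuousRep.cohomologyMap ((D (k + 1)).twistOne.toLocal (Sum.inr v)) ((D k).twistOne.toLocal (Sum.inr v))
        (IwasawaAlgebra.EisensteinCoeff.reduce p m (Nat.le_succ (k + 1))).toAddMonoidHom
        continuous_of_discreteTopology (fun _ z => W.reduce_twistOne κ hm cd D k _ z) 2 q = 0 := by
  letI := IwasawaAlgebra.isLocalRing_quotient_X_pow_add_C p hm
  have hpp := hp.out
  haveI : NeZero (p ^ (k + 1 + 1)) := ⟨pow_ne_zero _ hpp.ne_zero⟩
  have hpK : (p : K) ≠ 0 := by exact_mod_cast hpp.ne_zero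
  -- the bridge data `λ = λ_{k+2}` (tail form) and `exp = log⁻¹` at level `p^{k+2}`
  have hlam : ∀ (z : ℤ_[p]) (r : IwasawaAlgebra.EisensteinCoeff p m (k + 1 + 1)),
      (IwasawaAlgebra.EisensteinCoeff.tailFormZMod p hm (k + 1 + 1)).toAddMonoidHom
          (algebraMap ℤ_[p] (IwasawaAlgebra.EisensteinCoeff p m (k + 1 + 1)) z * r) =
        PadicInt.toZModPow (k + 1 + 1) z *
          (IwasawaAlgebra.EisensteinCoeff.tailFormZMod p hm (k + 1 + 1)).toAddMonoidHom r := fun z r ↦ by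
    rw [LinearMap.toAddMonoidHom_coe,
      IwasawaAlgebra.EisensteinCoeff.algebraMap_padicInt_eq_ofZMod_toZModPow p hm (k + 1 + 1),
      IwasawaAlgebra.EisensteinCoeff.tailFormZMod_ofZMod_mul]
  obtain ⟨log, hlogbij, hlogχ, -⟩ := exists_compatible_muLog K p hpK
  let Lg : MuCarrier K (p ^ (k + 1 + 1)) ≃+ ZMod (p ^ (k + 1 + 1)) :=
    AddEquiv.ofBijective (log (k + 1 + 1)) (hlogbij (k + 1 + 1))
  have hexpb : Function.Bijective (Lg.symm : ZMod (p ^ (k + 1 + 1)) →+ MuCarrier K (p ^ (k + 1 + 1))) :=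
    Lg.symm.bijective
  have hexp : ∀ (g : absoluteGaloisGroup K) (x : ZMod (p ^ (k + 1 + 1))),
      (Lg.symm : ZMod (p ^ (k + 1 + 1)) →+ MuCarrier K (p ^ (k + 1 + 1)))
          (cyclotomicCharacterModPow K p (k + 1 + 1) g * x) =
        mu K (p ^ (k + 1 + 1)) g ((Lg.symm : ZMod (p ^ (k + 1 + 1)) →+ MuCarrier K (p ^ (k + 1 + 1))) x) :=
    fun g x ↦ by
    apply Lg.injective
    change Lg (Lg.symm _) = log (k + 1 + 1) (mu K _ g (Lg.symm x))
    rw [AddEquiv.apply_symm_apply, hlogχ, show log (k + 1 + 1) (Lg.symm x) = Lg (Lg.symm x) from rfl,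
      AddEquiv.apply_symm_apply]
  have hbij := IwasawaAlgebra.EisensteinCoeff.bijective_comp_tailFormZMod_dualFamily_mul p hm (k + 1 + 1) _ hexpb
  -- `p^{k+1} = 0` on `A_{m,k+1}`
  have hR₂ : ∀ x : IwasawaAlgebra.EisensteinCoeff p m (k + 1), p ^ (k + 1) • x = 0 := fun x ↦ by
    haveI := IwasawaAlgebra.EisensteinCoeff.charP p hm (k + 1)
    rw [← Nat.cast_smul_eq_nsmul (IwasawaAlgebra.EisensteinCoeff p m (k + 1)),
      CharP.cast_eq_zero (IwasawaAlgebra.EisensteinCoeff p m (k + 1)) (p ^ (k + 1)), zero_smul]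
  -- the bijective local invariant map at `n = p^{k+2}`
  obtain ⟨inv, hperf, -, -, -⟩ := hPT (p ^ (k + 1 + 1))
  exact (D (k + 1)).cohomologyMap_two_eq_zero_of_prime_nsmul_eq_zero (D k) _ hlam _ hexp
    (IwasawaAlgebra.EisensteinCoeff.dualFamily p hm (k + 1 + 1)) hbij hR₂ _
    (fun g z => W.reduce_twistOne κ hm cd D k g z) v (inv (Sum.inr v)) (hperf v).1 q hq

/-! ### §5 The three clauses in the binder shapes of `Tower.levelCondition_mem_iff_forall_pairing_eq_zero` -/

/-- **The tower of induced local pairings of the curve's Eisenstein setting at a finite place `v`** — `X_j = H¹(K_v, T^{(j)})`,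
`Y_j = H¹(K_v, Tw T^{(j)})`, `Q_j = H²(K_v, A_{m,j+1}(1))`, `B_j = ∪_j` (`(D j).localCup`), reductions `H¹(red_j)`,
`H²(reduce(1))` — satisfies the clauses (hB), (hQ) and (T) (both sides, exponent `p^{k+1}` at level `k`) of the abstract
H.4 descent `Tower.levelCondition_mem_iff_forall_pairing_eq_zero`, given `he_red` and the Poitou–Tate named fact.
[cite: Howard2004HeegnerKolyvagin, §1.3 H.4, §1.6 (arXiv p. 11, L33–38) and Def. 3.1.2] [cite: MilneADT2006, Ch. I, Cor. 2.3] -/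
theorem eisensteinTower_localCup_towerCompat
    (he_red : letI := IwasawaAlgebra.isLocalRing_quotient_X_pow_add_C p hm
      ∀ k (x y : EisensteinLevel p m (fun j ↦ geomTorsion (W.baseChange K) ((p : ℤ) ^ j)) (k + 1 + 1)),
        IwasawaAlgebra.EisensteinCoeff.reduce p m (Nat.le_succ (k + 1)) ((D (k + 1)).e x y) =
          (D k).e ((W.eisensteinTower κ hm).red k x) ((W.eisensteinTower κ hm).red k y))
    (hPT : poitouTate_selmerStructure_duality K) (v : HeightOneSpectrum (𝓞 K)) (k : ℕ) :
    letI := IwasawaAlgebra.isLocalRing_quotient_X_pow_add_C p hm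
    (∀ (j : ℕ) (x : galoisCohomology (((W.eisensteinTower κ hm).ρ (j + 1)).toLocal (Sum.inr v)) 1)
        (y : galoisCohomology ((cd.twist ((W.eisensteinTower κ hm).ρ (j + 1))).toLocal (Sum.inr v)) 1),
        ContinuousRep.cohomologyMap ((D (j + 1)).twistOne.toLocal (Sum.inr v)) ((D j).twistOne.toLocal (Sum.inr v))
            (IwasawaAlgebra.EisensteinCoeff.reduce p m (Nat.le_succ (j + 1))).toAddMonoidHom
            continuous_of_discreteTopology (fun _ z => W.reduce_twistOne κ hm cd D j _ z) 2
            ((D (j + 1)).localCup (Sum.inr v) x y) =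
          (D j).localCup (Sum.inr v)
            (ContinuousRep.cohomologyMap (((W.eisensteinTower κ hm).ρ (j + 1)).toLocal (Sum.inr v))
              (((W.eisensteinTower κ hm).ρ j).toLocal (Sum.inr v)) ((W.eisensteinTower κ hm).red j).toAddMonoidHom
              continuous_of_discreteTopology (fun _ z => (W.eisensteinTower κ hm).red_equivariant j _ z) 1 x)
            (ContinuousRep.cohomologyMap ((cd.twist ((W.eisensteinTower κ hm).ρ (j + 1))).toLocal (Sum.inr v))
              ((cd.twist ((W.eisensteinTower κ hm).ρ j)).toLocal (Sum.inr v))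
              ((W.eisensteinTower κ hm).red j).toAddMonoidHom continuous_of_discreteTopology
              (fun _ z => (W.eisensteinTower κ hm).red_equivariant j _ z) 1 y)) ∧
      (∀ (j : ℕ) (q : galoisCohomology ((D (j + 1)).twistOne.toLocal (Sum.inr v)) 2), p • q = 0 →
        ContinuousRep.cohomologyMap ((D (j + 1)).twistOne.toLocal (Sum.inr v)) ((D j).twistOne.toLocal (Sum.inr v))
            (IwasawaAlgebra.EisensteinCoeff.reduce p m (Nat.le_succ (j + 1))).toAddMonoidHom
            continuous_of_discreteTopology (fun _ z => W.reduce_twistOne κ hm cd D j _ z) 2 q = 0) ∧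
      (∀ x : galoisCohomology (((W.eisensteinTower κ hm).ρ k).toLocal (Sum.inr v)) 1, p ^ (k + 1) • x = 0) ∧
      (∀ y : galoisCohomology ((cd.twist ((W.eisensteinTower κ hm).ρ k)).toLocal (Sum.inr v)) 1,
        p ^ (k + 1) • y = 0) :=
  ⟨fun j x y ↦ W.eisensteinTower_localCup_red κ hm cd D he_red j (Sum.inr v) x y,
    fun j q hq ↦ W.eisensteinTower_cohomologyMap_two_eq_zero_of_prime_nsmul_eq_zero κ hm cd D hPT j v q hq,
    fun x ↦ W.eisensteinTower_toLocal_pow_nsmul_eq_zero κ hm k (Sum.inr v) x,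
    fun y ↦ W.eisensteinTower_twist_toLocal_pow_nsmul_eq_zero κ hm cd k (Sum.inr v) y⟩

end WeierstrassCurve

end
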